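import Literature.AlgebraicGeometry.Resolution.ChowLemmaRing
import Literature.AlgebraicGeometry.Motives.GenericFibre
import Mathlib.CategoryTheory.Monoidal.Cartesian.Over
import HarnessLib

/-!
# A proper scheme over a domain covering, generically, a given model of a proper `K`-scheme

Topic: `Literature/AlgebraicGeometry/Limits` (input of the properness step, Stacks 081F, of the
spreading out of an abelian variety, `Literature.NumberTheory.EllipticCurves.NeronModelExistenceProofs`).
Let `A` be a commutative ring with fraction field `K` (`IsFractionRing A K`), `P → Spec A` an `A`-scheme whose generic fibre
`P_K = P ×_A Spec K` is identified with a proper integral `K`-scheme `E`. Then there are a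
**proper** `A`-scheme `Y` and an `A`-morphism `a : Y ⊗ Spec K → P` such that
`(a, pr₂) : Y ⊗ Spec K → P ⊗ Spec K = P_K` is surjective (`exists_proper_generic_cover`).

Proof (the one of Stacks 081F): Chow's lemma over `K`
(`Literature.AlgebraicGeometry.Resolution.ChowLemmaRing.chow_proper`, Görtz–Wedhorn I Thm. 13.100)
gives a proper surjective `π : X' → E` with `X'` integral and a closed immersion `X' ↪ ℙⁿ_K` over
`K`; since `ℙⁿ_K = ℙⁿ_A ×_A Spec K` (`ProjBaseChangeRing.isPullback_projMap`) the scheme-theoretic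
closure `Y` of `X'` in `ℙⁿ_A` is proper over `A` with generic fibre `X'`
(`Motives.isPullback_toImage_of_flat_mono`, Stacks 081I for the flat monomorphism `Spec K → Spec A`),
and `a` is `Y ⊗ Spec K ≅ X' → E ≅ P_K → P`.

## References

* The Stacks project, Tags 081F, 081I, 02O2 (Chow's lemma). [StacksProject]
* U. Görtz, T. Wedhorn, *Algebraic Geometry I: Schemes*, 2nd ed. (2020), Thm. 13.100. [GortzWedhorn2020]
-/

noncomputable section

universe u

open CategoryTheory CategoryTheory.Limits AlgebraicGeometry MonoidalCategory
  CartesianMonoidalCategory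

namespace Literature.AlgebraicGeometry.Limits

open Literature.AlgebraicGeometry.Motives (SchemeOver specOver)
open Literature.AlgebraicGeometry.Motives Literature.AlgebraicGeometry.Resolution

set_option backward.isDefEq.respectTransparency false

attribute [local instance] MvPolynomial.gradedAlgebra
  Literature.AlgebraicGeometry.Motives.ProjBaseChange.algebraBase

variable {A K : Type u} [CommRing A] [Field K] [Algebra A K] [IsFractionRing A K]

/-- **A proper `A`-scheme generically covering a model of a proper integral `K`-scheme**
(`K = Frac A`). Let `P → Spec A` and `e₀ : P ×_A Spec K ≅ E` with `E` proper and integral over `K`.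
Then there are a proper `A`-scheme `Y` and an `A`-morphism `a : Y ⊗ Spec K → P` with
`(a, pr₂) : Y ⊗ Spec K → P ⊗ Spec K` surjective: take a Chow cover `π : X' ↠ E`, `X' ↪ ℙⁿ_K`
closed (`ChowLemmaRing.chow_proper`), let `Y ⊆ ℙⁿ_A` be the scheme-theoretic closure of `X'`
(proper over `A`, generic fibre `X'` by `isPullback_toImage_of_flat_mono`), and
`a = (Y ⊗ Spec K ≅ X' ↠ E ≅ P ×_A Spec K → P)`.
[cite: StacksProject, Tag 081F (proof) with Tags 02O2, 081I] [cite: GortzWedhorn2020, Thm. 13.100] -/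
theorem exists_proper_generic_cover (P : SchemeOver A) (E : SchemeOver K) [IsProper E.hom]
    [IsIntegral E.left] (e₀ : (Over.pullback (specOver A K).hom).obj P ≅ E) :
    ∃ (Y : SchemeOver A) (a : Y ⊗ specOver A K ⟶ P), IsProper Y.hom ∧
      Function.Surjective (lift a (snd Y (specOver A K))).left := by
  classical
  haveI : Module.Flat A K := IsLocalization.flat K (nonZeroDivisors A)
  -- Chow's lemma over `K`
  obtain ⟨n, X', π, ι, hX', hι, hπ, hπs, hw, -⟩ := ChowLemmaRing.chow_proper (R := K) E.left E.hom
  haveI : @IsClosedImmersion X' (Proj (MvPolynomial.homogeneousSubmodule (Fin (n + 1)) K)) ι := hι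
  haveI : IsProper π := hπ
  haveI : Surjective π := hπs
  -- the base change `Spec K → Spec A`, a flat monomorphism
  set i : Spec (.of K) ⟶ Spec (.of A) := Spec.map (CommRingCat.ofHom (algebraMap A K)) with hi
  haveI : Flat i := Motives.flat_specMap_of_isLocalization A K (nonZeroDivisors A)
  haveI : Mono i := Motives.mono_specMap_of_isLocalization A K (nonZeroDivisors A)
  -- projective spaces: `ℙⁿ_K = ℙⁿ_A ×_A Spec K`
  set pA := ProjBaseChangeRing.projToSpec (Fin (n + 1)) A
  set pK := ProjBaseChangeRing.projToSpec (Fin (n + 1)) K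
  set φ := Proj.map (ProjBaseChangeRing.mapGraded A K (Fin (n + 1)))
    (ProjBaseChangeRing.irrelevant_le_map A K (Fin (n + 1)))
  have hP : IsPullback φ pK pA i := ProjBaseChangeRing.isPullback_projMap A K (Fin (n + 1))
  haveI : QuasiCompact φ := MorphismProperty.of_isPullback hP.flip inferInstance
  have hιw : ι ≫ pK = π ≫ E.hom := hw
  -- the closure `Y` of `X'` in `ℙⁿ_A`: proper over `A`, generic fibre `X'`
  set g := ι ≫ φ
  set f : g.image ⟶ Spec (.of A) := g.imageι ≫ pA
  have Hgen : IsPullback g.toImage (π ≫ E.hom) f i :=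
    Motives.isPullback_toImage_of_flat_mono i pA pK φ hP ι (π ≫ E.hom) hιw
  haveI : IsProper pA := ProjBaseChangeRing.isProper_projToSpec (Fin (n + 1)) A
  haveI : IsProper f := inferInstance
  let Y : SchemeOver A := Over.mk f
  -- the morphism `a : Y ⊗ Spec K ≅ X' → E ≅ P_K → P`
  let u : (Y ⊗ specOver A K).left ⟶ X' := Hgen.isoPullback.inv
  have hu : u ≫ π ≫ E.hom = pullback.snd f i := Hgen.isoPullback_inv_snd
  let aleft : (Y ⊗ specOver A K).left ⟶ P.left :=
    u ≫ π ≫ e₀.inv.left ≫ pullback.fst P.hom (specOver A K).hom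
  have haw : aleft ≫ P.hom = (Y ⊗ specOver A K).hom := by
    have h1 : e₀.inv.left ≫ pullback.snd P.hom (specOver A K).hom = E.hom := Over.w e₀.inv
    simp only [aleft, Category.assoc, pullback.condition]
    rw [reassoc_of% h1, reassoc_of% hu, Over.tensorObj_hom]
    exact pullback.condition.symm
  let a : Y ⊗ specOver A K ⟶ P := Over.homMk aleft haw
  refine ⟨Y, a, ‹IsProper f›, ?_⟩
  -- `(a, pr₂) = (Y ⊗ Spec K ≅ X' ↠ E ≅ P_K)` is surjective
  have hleft : (lift a (snd Y (specOver A K))).left = u ≫ π ≫ e₀.inv.left := by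
    rw [Over.lift_left]
    apply pullback.hom_ext
    · rw [pullback.lift_fst]
      simp only [a, aleft, Over.homMk_left, Category.assoc]
    · rw [pullback.lift_snd, Over.snd_left, Category.assoc, Category.assoc]
      have h1 : e₀.inv.left ≫ pullback.snd P.hom (specOver A K).hom = E.hom := Over.w e₀.inv
      rw [h1, hu]
      rfl
  haveI : IsIso e₀.inv.left := ((Over.forget _).mapIso e₀.symm).isIso_hom
  rw [hleft]
  exact (u ≫ π ≫ e₀.inv.left).surjective

end Literature.AlgebraicGeometry.Limits

end
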